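import Summits.AtomisticToContinuum.HydrodynamicLimit.Theorems.JParityClosureRateFloorPairFunctionalVelocityStats
import Summits.AtomisticToContinuum.HydrodynamicLimit.Theorems.JParityClosureEvenStressEnskogVelocityFactorisation
import Literature.MathematicalPhysics.KineticTheory.HardSphereUniformDensityLLN
import HarnessLib

/-!
# The B-side of `RateFloor` at rung 0, III: the three `G`-level terms (helper file, `--supports stmt-AtomisticToContinuum-13080`)

Crux `JParityClosure.RateFloor` (stmt-AtomisticToContinuum-13080), line `Sketch`, rung-0 stub `stub_staticOpacityFloorRung0`.
Under the rung-0 local Gibbs law `G_N = posGibbsMeasure ⊗ N(u,θ)^{⊗(N+1)}` (`HardSphereUniformGas`), `M = 3/(πr³)`: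

* `integral_abs_pairFunctional_sub_mul_offDiag_le` — velocity term: for a continuous mark with `|Θ Ξ′| ≤ C_Θ`,
  `E_G|B_r Ξ′ − Θ̄′ Q| ≤ η/2 + 8M⁴C_Θ²/((N+1)·2η)` (disintegration `integral_localGibbsLaw_const_eq_integral_integral` +
  `integral_vel_abs_pairFunctional_sub_le`);
* `integral_abs_offDiag_sub_one_le` — position term: `E_G|Q − 1| ≤ (M+1)(η′ + V_N/(4η′)) + M²/(N+1)`,
  `V_N = E_P(ρ̃_r(·,x₀) − 1)²` (`abs_offDiag_sub_one_le`, AM–GM, position marginal);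
* `integral_pairFunctional_tail_le` — tail term: `E_G[B_r(Ξ(1−ψ_L))] ≤ 4M²(C|S²|/L)(‖u‖² + 3θ)` (`pairFunctional_tail_le`,
  velocity marginal, `integral_avg_norm_sq_pi_gauss`).
-/

noncomputable section

open MeasureTheory ProbabilityTheory Set Filter Topology
open scoped ENNReal InnerProductSpace BigOperators

namespace Summit.AtomisticToContinuum.HydrodynamicLimit.Theorems

namespace RateFloorPairFunctionalUpper

open Literature.Analysis.FluidPDE Literature.MathematicalPhysics.KineticTheory
open Literature.Probability.Moments
open Summit.AtomisticToContinuum.HydrodynamicLimit.Theorems.EvenStressEnskog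

/-! ## The three `G`-level terms -/

/-- **(1) The velocity term at the level of `G`**: for a continuous mark `Ξ'` with `|Θ Ξ'| ≤ C_Θ`,
`E_G|B_r Ξ' − Θ̄' Q| ≤ η/2 + 8M⁴C_Θ²/((N+1)·2η)` (disintegration + `integral_vel_abs_pairFunctional_sub_le`). [folklore] -/
theorem integral_abs_pairFunctional_sub_mul_offDiag_le {σ a θ : ℝ} {u : V3} (hσ2 : σ ≤ 1 / 2) (ha : 0 < a)
    (hθ : 0 < θ) {Ξ : V3 × V3 × V3 → ℝ} (hΞc : Continuous Ξ) {CΘ : ℝ} (hΘb : ∀ v w, |sphereMark Ξ v w| ≤ CΘ)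
    {r : ℝ} (hr : 0 < r) (x₀ : T3) (N : ℕ) (Φ : HardSphereFlow (Torus.geometry (Fin 3)) (hsDiameter σ N) (N + 1))
    {η : ℝ} (hη : 0 < η) :
    ∫ z, |pairFunctional r Ξ z x₀ -
        (∫ p, sphereMark Ξ p.1 p.2 ∂((gaussMeasure u θ).prod (gaussMeasure u θ))) *
          ((((N + 1 : ℕ) : ℝ))⁻¹ * (((N + 1 : ℕ) : ℝ))⁻¹ *
            ∑ i, ∑ j, if i = j then 0 else coneKernel r (z i).1 x₀ * coneKernel r (z j).1 x₀)|
        ∂(localGibbsLaw σ (fun _ => a) (fun _ => u) (fun _ => θ) N Φ) ≤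
      η / 2 + 8 * (3 / (Real.pi * r ^ 3)) ^ 4 * CΘ ^ 2 * (((N + 1 : ℕ) : ℝ))⁻¹ / (2 * η) := by
  set M : ℝ := 3 / (Real.pi * r ^ 3) with hM
  set n : ℝ := ((N + 1 : ℕ) : ℝ) with hn
  set Θb : ℝ := ∫ p, sphereMark Ξ p.1 p.2 ∂((gaussMeasure u θ).prod (gaussMeasure u θ)) with hΘbdef
  set f : Config (N + 1) (Fin 3) T3 → ℝ := fun z => pairFunctional r Ξ z x₀ -
    Θb * (n⁻¹ * n⁻¹ * ∑ i, ∑ j, if i = j then 0 else coneKernel r (z i).1 x₀ * coneKernel r (z j).1 x₀) with hf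
  haveI : IsProbabilityMeasure (localGibbsLaw σ (fun _ => a) (fun _ => u) (fun _ => θ) N Φ) :=
    isProbabilityMeasure_localGibbsLaw continuous_const continuous_const continuous_const (fun _ => ha) (fun _ => hθ) hσ2 N Φ
  haveI : IsProbabilityMeasure (posGibbsMeasure (fun _ : T3 => a) (hsDiameter σ N) (N + 1)) :=
    isProbabilityMeasure_posGibbsMeasure continuous_const (fun _ => ha) hσ2 N
  have hn0 : 0 < n := by rw [hn]; positivity
  have hM0 : 0 ≤ M := by rw [hM]; positivity
  have hCΘ0 : 0 ≤ CΘ := (abs_nonneg _).trans (hΘb 0 0)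
  have hbM : ∀ (z : Config (N + 1) (Fin 3) T3) i, 0 ≤ coneKernel r (z i).1 x₀ ∧ coneKernel r (z i).1 x₀ ≤ M :=
    fun z i => coneKernel_nonneg_le hr (z i).1 x₀
  -- continuity and a uniform bound of `f`
  have hfc : Continuous f := by
    refine (continuous_pairFunctional_comp r hΞc continuous_id continuous_const).sub
      (continuous_const.mul (continuous_const.mul (continuous_finsetSum _ fun i _ => continuous_finsetSum _ fun j _ => ?_)))
    split_ifs
    · exact continuous_const
    · exact (continuous_coneKernel_comp r (continuous_apply i).fst continuous_const).mul
        (continuous_coneKernel_comp r (continuous_apply j).fst continuous_const)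
  have hΘb' : |Θb| ≤ CΘ := by
    have h := norm_integral_le_of_norm_le_const (μ := (gaussMeasure u θ).prod (gaussMeasure u θ))
      (f := fun p : V3 × V3 => sphereMark Ξ p.1 p.2) (C := CΘ) (ae_of_all _ fun p => by rw [Real.norm_eq_abs]; exact hΘb p.1 p.2)
    simpa only [Real.norm_eq_abs, probReal_univ, mul_one] using h
  have hfb : ∀ z, |f z| ≤ M * M * CΘ + CΘ * (M * M) := fun z => by
    refine (abs_sub _ _).trans (add_le_add ?_ ?_)
    · rw [pairFunctional_eq_sum]
      refine (abs_const_mul_sum_sum_le_of (B := M * M * CΘ) (by positivity) _ fun i j => ?_).trans (le_of_eq ?_)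
      · rw [abs_mul, abs_mul, abs_of_nonneg (hbM z i).1, abs_of_nonneg (hbM z j).1]
        exact mul_le_mul (mul_le_mul (hbM z i).2 (hbM z j).2 (hbM z j).1 hM0) (hΘb _ _) (abs_nonneg _) (mul_nonneg hM0 hM0)
      · have hN : ((N : ℝ) + 1) ≠ 0 := by positivity
        push_cast; field_simp
    · rw [abs_mul]
      refine mul_le_mul hΘb' ?_ (abs_nonneg _) hCΘ0
      refine (abs_const_mul_sum_sum_le_of (B := M * M) (mul_nonneg (inv_nonneg.2 hn0.le) (inv_nonneg.2 hn0.le)) _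
        fun i j => ?_).trans (le_of_eq ?_)
      · split_ifs
        · rw [abs_zero]; exact mul_nonneg hM0 hM0
        · rw [abs_mul, abs_of_nonneg (hbM z i).1, abs_of_nonneg (hbM z j).1]
          exact mul_le_mul (hbM z i).2 (hbM z j).2 (hbM z j).1 hM0
      · have hN : ((N : ℝ) + 1) ≠ 0 := by positivity
        rw [hn]; push_cast; field_simp
  have hfi : Integrable (fun z => |f z|) (localGibbsLaw σ (fun _ => a) (fun _ => u) (fun _ => θ) N Φ) :=
    (Integrable.of_bound hfc.measurable.aestronglyMeasurable _ (ae_of_all _ fun z => by rw [Real.norm_eq_abs]; exact hfb z)).abs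
  rw [show (fun z => |pairFunctional r Ξ z x₀ - Θb * ((((N + 1 : ℕ) : ℝ))⁻¹ * (((N + 1 : ℕ) : ℝ))⁻¹ *
      ∑ i, ∑ j, if i = j then 0 else coneKernel r (z i).1 x₀ * coneKernel r (z j).1 x₀)|) = fun z => |f z| from rfl,
    integral_localGibbsLaw_const_eq_integral_integral σ ha.le hθ u N Φ hfi]
  have hinner : ∀ xs : Fin (N + 1) → T3,
      ∫ vs, |f (zipConfig (xs, vs))| ∂(Measure.pi fun _ : Fin (N + 1) => gaussMeasure u θ) ≤
        η / 2 + 8 * M ^ 4 * CΘ ^ 2 * n⁻¹ / (2 * η) := by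
    intro xs
    have h := integral_vel_abs_pairFunctional_sub_le u θ hΞc hΘb hr xs x₀ hη
    simpa only [hf, zipConfig_apply] using h
  calc ∫ xs, ∫ vs, |f (zipConfig (xs, vs))| ∂(Measure.pi fun _ : Fin (N + 1) => gaussMeasure u θ)
        ∂posGibbsMeasure (fun _ : T3 => a) (hsDiameter σ N) (N + 1)
      ≤ ∫ _xs, (η / 2 + 8 * M ^ 4 * CΘ ^ 2 * n⁻¹ / (2 * η)) ∂posGibbsMeasure (fun _ : T3 => a) (hsDiameter σ N) (N + 1) :=
        integral_mono_of_nonneg (ae_of_all _ fun xs => integral_nonneg fun vs => abs_nonneg _)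
          (integrable_const _) (ae_of_all _ hinner)
    _ = η / 2 + 8 * M ^ 4 * CΘ ^ 2 * n⁻¹ / (2 * η) := by rw [integral_const, smul_eq_mul, probReal_univ, one_mul]

/-- **(2) The position term at the level of `G`**: for `r > 0` and `η′ > 0`,
`E_G|Q − 1| ≤ (M+1)(η′ + V_N/(4η′)) + M²/(N+1)`, `V_N = E_P(ρ̃_r(·,x₀) − 1)²` (`abs_offDiag_sub_one_le`, AM–GM
`|x| ≤ η′ + x²/(4η′)`, position marginal). [folklore] -/
theorem integral_abs_offDiag_sub_one_le {σ a θ : ℝ} {u : V3} (hσ2 : σ ≤ 1 / 2) (ha : 0 < a) (hθ : 0 < θ)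
    {r : ℝ} (hr : 0 < r) (x₀ : T3) (N : ℕ) (Φ : HardSphereFlow (Torus.geometry (Fin 3)) (hsDiameter σ N) (N + 1))
    {η' : ℝ} (hη' : 0 < η') :
    ∫ z, |(((N + 1 : ℕ) : ℝ))⁻¹ * (((N + 1 : ℕ) : ℝ))⁻¹ *
          (∑ i, ∑ j, if i = j then 0 else coneKernel r (z i).1 x₀ * coneKernel r (z j).1 x₀) - 1|
        ∂(localGibbsLaw σ (fun _ => a) (fun _ => u) (fun _ => θ) N Φ) ≤
      (3 / (Real.pi * r ^ 3) + 1) * (η' + (∫ xs, (empDensity r xs x₀ - 1) ^ 2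
          ∂posGibbsMeasure (fun _ : T3 => a) (hsDiameter σ N) (N + 1)) / (4 * η')) +
        (3 / (Real.pi * r ^ 3)) ^ 2 * (((N + 1 : ℕ) : ℝ))⁻¹ := by
  set M : ℝ := 3 / (Real.pi * r ^ 3) with hM
  set n : ℝ := ((N + 1 : ℕ) : ℝ) with hn
  set G := localGibbsLaw σ (fun _ => a) (fun _ => u) (fun _ => θ) N Φ with hG
  set P := posGibbsMeasure (fun _ : T3 => a) (hsDiameter σ N) (N + 1) with hP
  set ρ : Config (N + 1) (Fin 3) T3 → ℝ := fun z => n⁻¹ * ∑ i, coneKernel r (z i).1 x₀ with hρ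
  set Qm : Config (N + 1) (Fin 3) T3 → ℝ := fun z =>
    n⁻¹ * n⁻¹ * (∑ i, ∑ j, if i = j then 0 else coneKernel r (z i).1 x₀ * coneKernel r (z j).1 x₀) - 1 with hQm
  haveI : IsProbabilityMeasure G := isProbabilityMeasure_localGibbsLaw continuous_const continuous_const continuous_const
    (fun _ => ha) (fun _ => hθ) hσ2 N Φ
  haveI : IsProbabilityMeasure P := isProbabilityMeasure_posGibbsMeasure continuous_const (fun _ => ha) hσ2 N
  have hn0 : 0 < n := by rw [hn]; positivity
  have hM0 : 0 ≤ M := by rw [hM]; positivity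
  have hbM : ∀ (z : Config (N + 1) (Fin 3) T3) i, 0 ≤ coneKernel r (z i).1 x₀ ∧ coneKernel r (z i).1 x₀ ≤ M :=
    fun z i => coneKernel_nonneg_le hr (z i).1 x₀
  -- pointwise
  have hdev : ∀ z, |Qm z| ≤ (M + 1) * (η' + (ρ z - 1) ^ 2 / (4 * η')) + M ^ 2 * n⁻¹ := fun z => by
    have h1 : |Qm z| ≤ (M + 1) * |ρ z - 1| + M ^ 2 * n⁻¹ := by
      have h := abs_offDiag_sub_one_le (n := N + 1) hM0 (fun i => coneKernel r (z i).1 x₀) (hbM z)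
      simpa only [hQm, hρ, hn] using h
    have h2 : |ρ z - 1| ≤ η' + (ρ z - 1) ^ 2 / (4 * η') := by
      rw [← sub_nonneg]
      have e : η' + (ρ z - 1) ^ 2 / (4 * η') - |ρ z - 1| = (|ρ z - 1| - 2 * η') ^ 2 / (4 * η') := by
        rw [← sq_abs (ρ z - 1)]; field_simp; ring
      rw [e]; positivity
    exact h1.trans (add_le_add (mul_le_mul_of_nonneg_left h2 (by linarith)) le_rfl)
  -- continuity, bounds, integrability
  have hbc : ∀ i : Fin (N + 1), Continuous fun z : Config (N + 1) (Fin 3) T3 => coneKernel r (z i).1 x₀ := fun i =>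
    continuous_coneKernel_comp r (continuous_apply i).fst continuous_const
  have hρc : Continuous ρ := continuous_const.mul (continuous_finsetSum _ fun i _ => hbc i)
  have hQmc : Continuous Qm := by
    refine (continuous_const.mul (continuous_finsetSum _ fun i _ => continuous_finsetSum _ fun j _ => ?_)).sub continuous_const
    split_ifs
    · exact continuous_const
    · exact (hbc i).mul (hbc j)
  have hρM : ∀ z, |ρ z - 1| ≤ M + 1 := fun z => by
    refine (abs_sub _ _).trans (add_le_add ?_ (by norm_num))
    rw [abs_of_nonneg (mul_nonneg (inv_nonneg.2 hn0.le) (Finset.sum_nonneg fun i _ => (hbM z i).1))]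
    calc n⁻¹ * ∑ i, coneKernel r (z i).1 x₀ ≤ n⁻¹ * ∑ _i : Fin (N + 1), M :=
          mul_le_mul_of_nonneg_left (Finset.sum_le_sum fun i _ => (hbM z i).2) (inv_nonneg.2 hn0.le)
      _ = M := by
          rw [Finset.sum_const, Finset.card_univ, Fintype.card_fin, nsmul_eq_mul, ← hn, ← mul_assoc, inv_mul_cancel₀ hn0.ne', one_mul]
  have hsqi : Integrable (fun z => (ρ z - 1) ^ 2) G :=
    Integrable.of_bound ((hρc.sub continuous_const).pow 2).measurable.aestronglyMeasurable ((M + 1) ^ 2)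
      (ae_of_all _ fun z => by rw [Real.norm_eq_abs, abs_pow]; exact pow_le_pow_left₀ (abs_nonneg _) (hρM z) 2)
  have hQmabs : ∀ z, |Qm z| ≤ (M + 1) * (M + 1) + M ^ 2 * n⁻¹ + 1 := fun z => by
    have h := hdev z
    have h' : (M + 1) * (η' + (ρ z - 1) ^ 2 / (4 * η')) + M ^ 2 * n⁻¹ ≤ (M + 1) * (η' + (ρ z - 1) ^ 2 / (4 * η')) + M ^ 2 * n⁻¹ := le_rfl
    -- a cruder direct bound
    have h1 : |Qm z| ≤ (M + 1) * |ρ z - 1| + M ^ 2 * n⁻¹ := by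
      have h := abs_offDiag_sub_one_le (n := N + 1) hM0 (fun i => coneKernel r (z i).1 x₀) (hbM z)
      simpa only [hQm, hρ, hn] using h
    nlinarith [hρM z, abs_nonneg (ρ z - 1), hM0]
  have hQmi : Integrable (fun z => |Qm z|) G :=
    (Integrable.of_bound hQmc.measurable.aestronglyMeasurable _ (ae_of_all _ fun z => by rw [Real.norm_eq_abs]; exact hQmabs z)).abs
  have hR1 : Integrable (fun z => η' + (ρ z - 1) ^ 2 / (4 * η')) G := (integrable_const η').add (hsqi.div_const _)
  have hR2 : Integrable (fun z => (M + 1) * (η' + (ρ z - 1) ^ 2 / (4 * η'))) G := hR1.const_mul _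
  have hR3 : Integrable (fun z => (M + 1) * (η' + (ρ z - 1) ^ 2 / (4 * η')) + M ^ 2 * n⁻¹) G := hR2.add (integrable_const _)
  -- the position variance under `G` is `V`
  have hVG : ∫ z, (ρ z - 1) ^ 2 ∂G = ∫ xs, (empDensity r xs x₀ - 1) ^ 2 ∂P := by
    have h := integral_pos_localGibbsLaw_const σ ha.le hθ u N Φ (fun xs => (empDensity r xs x₀ - 1) ^ 2)
    refine (integral_congr_ae (ae_of_all _ fun z => ?_)).trans h
    simp only [hρ, empDensity, hn]
  have e1 : ∫ z, (η' + (ρ z - 1) ^ 2 / (4 * η')) ∂G = η' + (∫ z, (ρ z - 1) ^ 2 ∂G) / (4 * η') := by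
    rw [integral_add (integrable_const η') (hsqi.div_const _), integral_const, smul_eq_mul, probReal_univ, one_mul,
      integral_div]
  have e2 : ∫ z, ((M + 1) * (η' + (ρ z - 1) ^ 2 / (4 * η')) + M ^ 2 * n⁻¹) ∂G =
      (M + 1) * (η' + (∫ z, (ρ z - 1) ^ 2 ∂G) / (4 * η')) + M ^ 2 * n⁻¹ := by
    rw [integral_add hR2 (integrable_const _), integral_const_mul, e1, integral_const, smul_eq_mul, probReal_univ, one_mul]
  calc ∫ z, |Qm z| ∂G ≤ ∫ z, ((M + 1) * (η' + (ρ z - 1) ^ 2 / (4 * η')) + M ^ 2 * n⁻¹) ∂G := integral_mono hQmi hR3 hdev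
    _ = (M + 1) * (η' + (∫ xs, (empDensity r xs x₀ - 1) ^ 2 ∂P) / (4 * η')) + M ^ 2 * n⁻¹ := by rw [e2, hVG]

/-- **(3) The tail term at the level of `G`**: for `0 ≤ Ξ ≤ C`, `L > 0`, `r > 0`,
`E_G[B_r (Ξ(1−ψ_L))] ≤ 4M² (C|S²|/L) (‖u‖² + 3θ)` (pointwise bound `pairFunctional_tail_le` + velocity marginal). [folklore] -/
theorem integral_pairFunctional_tail_le {σ a θ : ℝ} {u : V3} (hσ2 : σ ≤ 1 / 2) (ha : 0 < a) (hθ : 0 < θ)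
    {Ξ : V3 × V3 × V3 → ℝ} (hΞc : Continuous Ξ) (hΞ0 : ∀ q, 0 ≤ Ξ q) {C : ℝ} (hΞC : ∀ q, Ξ q ≤ C)
    {r : ℝ} (hr : 0 < r) (x₀ : T3) (N : ℕ) (Φ : HardSphereFlow (Torus.geometry (Fin 3)) (hsDiameter σ N) (N + 1))
    {L : ℝ} (hL : 0 < L) :
    ∫ z, pairFunctional r (fun q => Ξ q * (1 - speedCutoff L ‖q.2.2 - q.2.1‖)) z x₀
        ∂(localGibbsLaw σ (fun _ => a) (fun _ => u) (fun _ => θ) N Φ) ≤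
      4 * (3 / (Real.pi * r ^ 3)) ^ 2 * (C * (sphereMeasure : Measure (Metric.sphere (0 : V3) 1)).real univ / L) *
        (‖u‖ ^ 2 + 3 * θ) := by
  set G := localGibbsLaw σ (fun _ => a) (fun _ => u) (fun _ => θ) N Φ with hG
  set n : ℝ := ((N + 1 : ℕ) : ℝ) with hn
  set K' : ℝ := 4 * (3 / (Real.pi * r ^ 3)) ^ 2 * (C * (sphereMeasure : Measure (Metric.sphere (0 : V3) 1)).real univ / L)
    with hK'
  haveI : IsProbabilityMeasure G := isProbabilityMeasure_localGibbsLaw continuous_const continuous_const continuous_const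
    (fun _ => ha) (fun _ => hθ) hσ2 N Φ
  haveI : IsProbabilityMeasure (posGibbsMeasure (fun _ : T3 => a) (hsDiameter σ N) (N + 1)) :=
    isProbabilityMeasure_posGibbsMeasure continuous_const (fun _ => ha) hσ2 N
  have hΞtc : Continuous fun q : V3 × V3 × V3 => Ξ q * (1 - speedCutoff L ‖q.2.2 - q.2.1‖) := continuous_tailMark hΞc L
  have hΞt0 : ∀ q : V3 × V3 × V3, 0 ≤ Ξ q * (1 - speedCutoff L ‖q.2.2 - q.2.1‖) := fun q => (tailMark_nonneg_le hΞ0 L q).1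
  -- the dominating velocity function is `G`-integrable with integral `K' m₂`
  have hvel_meas : AEStronglyMeasurable (fun z : Config (N + 1) (Fin 3) T3 => K' * (n⁻¹ * ∑ i, ‖(z i).2‖ ^ 2)) G :=
    (continuous_const.mul (continuous_const.mul
      (continuous_finsetSum _ fun i _ => ((continuous_apply i).snd.norm).pow 2))).measurable.aestronglyMeasurable
  have hveli : Integrable (fun z : Config (N + 1) (Fin 3) T3 => K' * (n⁻¹ * ∑ i, ‖(z i).2‖ ^ 2)) G := by
    rw [hG, integrable_localGibbsLaw_const_iff σ ha.le hθ u N Φ]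
    have hΓi : Integrable (fun vs : Fin (N + 1) → V3 => K' * (n⁻¹ * ∑ i, ‖vs i‖ ^ 2))
        (Measure.pi fun _ : Fin (N + 1) => gaussMeasure u θ) := by
      refine ((integrable_finsetSum _ fun i _ => ?_).const_mul _).const_mul _
      have hmp := measurePreserving_eval (fun _ : Fin (N + 1) => gaussMeasure u θ) i
      exact (hmp.integrable_comp (continuous_norm.pow 2).aestronglyMeasurable).2 (integrable_norm_sq_gaussMeasure u θ)
    have h := hΓi.comp_snd (posGibbsMeasure (fun _ : T3 => a) (hsDiameter σ N) (N + 1))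
    refine h.congr (ae_of_all _ fun p => ?_)
    simp only [zipConfig_apply]
  have hvel_int : ∫ z, K' * (n⁻¹ * ∑ i, ‖(z i).2‖ ^ 2) ∂G = K' * (‖u‖ ^ 2 + 3 * θ) := by
    rw [integral_const_mul]
    congr 1
    have h := integral_vel_localGibbsLaw_const σ ha.le hθ u N Φ (fun vs : Fin (N + 1) → V3 => n⁻¹ * ∑ i, ‖vs i‖ ^ 2)
    rw [hG, h, probReal_univ, one_smul, hn, integral_avg_norm_sq_pi_gauss u hθ]
  -- integrability of the tail functional by domination
  have hpt : ∀ z : Config (N + 1) (Fin 3) T3,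
      pairFunctional r (fun q => Ξ q * (1 - speedCutoff L ‖q.2.2 - q.2.1‖)) z x₀ ≤ K' * (n⁻¹ * ∑ i, ‖(z i).2‖ ^ 2) :=
    fun z => pairFunctional_tail_le hr hΞc hΞ0 hΞC hL z x₀
  have h0 : ∀ z : Config (N + 1) (Fin 3) T3, 0 ≤ pairFunctional r (fun q => Ξ q * (1 - speedCutoff L ‖q.2.2 - q.2.1‖)) z x₀ :=
    fun z => pairFunctional_nonneg hr hΞt0 z x₀
  have hti : Integrable (fun z => pairFunctional r (fun q => Ξ q * (1 - speedCutoff L ‖q.2.2 - q.2.1‖)) z x₀) G :=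
    Integrable.mono' hveli (continuous_pairFunctional_comp r hΞtc continuous_id continuous_const).measurable.aestronglyMeasurable
      (ae_of_all _ fun z => by rw [Real.norm_eq_abs, abs_of_nonneg (h0 z)]; exact hpt z)
  calc ∫ z, pairFunctional r (fun q => Ξ q * (1 - speedCutoff L ‖q.2.2 - q.2.1‖)) z x₀ ∂G
      ≤ ∫ z, K' * (n⁻¹ * ∑ i, ‖(z i).2‖ ^ 2) ∂G := integral_mono hti hveli hpt
    _ = K' * (‖u‖ ^ 2 + 3 * θ) := hvel_int

/-- **Registered helper stub `stub_pairFunctionalTailTermRung0`** of crux stmt-AtomisticToContinuum-13080 (line `Sketch`, input of `stub_staticOpacityFloorRung0`),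
closed signature form of the file's main result. [folklore] -/
theorem stub_pairFunctionalTailTermRung0 : ∀ (σ a θ : ℝ) (u : V3), σ ≤ 1 / 2 → 0 < a → 0 < θ → ∀ (Ξ : V3 × V3 × V3 → ℝ), Continuous Ξ → (∀ q, 0 ≤ Ξ q) → ∀ (C : ℝ), (∀ q, Ξ q ≤ C) → ∀ (r : ℝ), 0 < r → ∀ (x₀ : T3) (N : ℕ) (Φ : HardSphereFlow (Torus.geometry (Fin 3)) (hsDiameter σ N) (N + 1)) (L : ℝ), 0 < L → ∫ z, pairFunctional r (fun q => Ξ q * (1 - speedCutoff L ‖q.2.2 - q.2.1‖)) z x₀ ∂(localGibbsLaw σ (fun _ => a) (fun _ => u) (fun _ => θ) N Φ) ≤ 4 * (3 / (Real.pi * r ^ 3)) ^ 2 * (C * (sphereMeasure : MeasureTheory.Measure (Metric.sphere (0 : V3) 1)).real Set.univ / L) * (‖u‖ ^ 2 + 3 * θ) :=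
  fun _σ _a _θ u hσ2 ha hθ _Ξ hΞc hΞ0 _C hΞC _r hr x₀ N Φ _L hL =>
    integral_pairFunctional_tail_le (u := u) hσ2 ha hθ hΞc hΞ0 hΞC hr x₀ N Φ hL

/-- The speed cutoff is nonnegative. [folklore] -/
theorem speedCutoff_nonneg (L s : ℝ) : 0 ≤ speedCutoff L s := (speedCutoff_mem_Icc L s).1

/-- The speed cutoff is at most one. [folklore] -/
theorem speedCutoff_le_one (L s : ℝ) : speedCutoff L s ≤ 1 := (speedCutoff_mem_Icc L s).2

end RateFloorPairFunctionalUpper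

end Summit.AtomisticToContinuum.HydrodynamicLimit.Theorems

end
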